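import Literature.Analysis.FluidPDE.JiaSverak2014PerturbedOnSlab
import Literature.Analysis.FluidPDE.ESSLocalHolderRepresentative
import Literature.Analysis.FluidPDE.SuitableWeakCongr
import HarnessLib

/-!
# The pressure gauge of ROUND-27 «THE √2 APEX» (T27-A assembly): a classical window pressure of the
# representative differs from the package pressure by a function of time, so the SHELL `L¹` BUDGET of `P`
# transfers to every window pressure (item `TerminalTrace.TypeITraceScarL3`, stmt-NavierStokesRegularity-18385,
# Stub LOUD line; helpers)

Seat nsreg-C26-p1 g2 (cell ns-regularity-ideate), `--supports stmt-NavierStokesRegularity-18385` (helper).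

* `ae_exists_gauge_window_pressure` — `(U, P)` suitable in every `Q(a)` at the origin, `U = V` a.e. on the lower
  slab, `(V, q)` classical on a window `]α, β[`, `β ≤ 0`: for a.e. `t ∈ ]α, β[`, `P(t, ·) − q(t, ·)` is a.e.
  CONSTANT (both `(V, P)` and `(V, q)` solve Navier–Stokes in `𝒟'(]α,β[ × ℝ³)`, subtract and apply the tree's
  `ae_exists_const_of_forall_integral_mul_divergence_eq_zero`; verbatim the pattern of the tree's
  `exists_gauge_two_pressures`).
* `reprBudget_of_shellBudget` — hence a gauge-free budget `∫_S |P(s) − c(s)| ≤ m_P` for a.e. `s` on an open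
  shell `S` yields, for EVERY late time `t` and every window pressure `q` of `V` about `t`, a constant `c'` with
  `∫_K |q(t) − c'| ≤ m_P + 1` on any compact annulus `K ⊆ S` (a.e. in time first; then at `t` itself by the
  uniform continuity of `q` on `[t−η, t+η] × K` and the positivity of Lebesgue measure on intervals).

WHAT THIS IS NOT: not T27-A, not NS regularity — bookkeeping.  [folklore; JiaSverak2014 §3 (3.3); RusinSverak2011
§2]
-/

noncomputable section

set_option linter.dupNamespace false

namespace Summit.NavierStokesRegularity.NavierStokesRegularity.Theorems.TypeITraceScarL3

open MeasureTheory Set Function Filter Topology Metric InnerProductSpace TopologicalSpace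
open Literature.Analysis Literature.Analysis.FluidPDE
open scoped NNReal ENNReal RealInnerProductSpace ContDiff Laplacian

/-- **The window pressure is the package pressure up to a gauge** (module docstring).
[cite: JiaSverak2014, §3 (3.3)] -/
theorem ae_exists_gauge_window_pressure
    {U V : ℝ → EuclideanSpace ℝ (Fin 3) → EuclideanSpace ℝ (Fin 3)}
    {P q : ℝ → EuclideanSpace ℝ (Fin 3) → ℝ}
    (hsw : ∀ a : ℝ, 0 < a →
      IsSuitableWeakSolutionInBall a (0 : ℝ × EuclideanSpace ℝ (Fin 3)) U P)
    (hUV : ∀ᵐ w ∂(volume.restrict (Iio (0 : ℝ) ×ˢ (univ : Set (EuclideanSpace ℝ (Fin 3))))),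
      uncurry U w = uncurry V w)
    {α β : ℝ} (hβ : β ≤ 0) (hcl : IsClassicalNSSolutionOn (Ioo α β) 1 0 V q) :
    ∀ᵐ t ∂(volume.restrict (Ioo α β)), ∃ κ : ℝ, ∀ᵐ x ∂(volume : Measure (EuclideanSpace ℝ (Fin 3))),
      P t x - q t x = κ := by
  set Q : Opens (ℝ × EuclideanSpace ℝ (Fin 3)) := slab (EuclideanSpace ℝ (Fin 3)) (Ioo α β) isOpen_Ioo with hQ
  have hQset : (Q : Set (ℝ × EuclideanSpace ℝ (Fin 3))) = Ioo α β ×ˢ univ := coe_slab _ _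
  have hQslab : (Q : Set (ℝ × EuclideanSpace ℝ (Fin 3))) ⊆ Iio (0 : ℝ) ×ˢ univ := by
    rw [hQset]; exact prod_mono (fun t ht => lt_of_lt_of_le ht.2 hβ) Subset.rfl
  have hQI : (Q : Set (ℝ × EuclideanSpace ℝ (Fin 3))) ⊆ Ioo α β ×ˢ (univ : Set (EuclideanSpace ℝ (Fin 3))) :=
    hQset.le
  -- ### the two distributional identities on `Q`, with the SAME velocity `V`
  have hDU : IsDistributionalNSSolutionOn Q 1 0 U P := by
    have h := isDistributionalNSSolutionOn_of_forall_cylinder (fun a ha => (hsw a ha).1.distributional)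
      (isOpen_Ioo.prod isOpen_univ) (hQset ▸ hQslab)
    have e : Q = ⟨Ioo α β ×ˢ univ, isOpen_Ioo.prod isOpen_univ⟩ := Opens.ext hQset
    rw [e]; exact h
  have hD₁ : IsDistributionalNSSolutionOn Q 1 0 V P :=
    hDU.congr_ae (ae_restrict_of_ae_restrict_of_subset hQslab hUV) (ae_of_all _ fun _ => rfl)
  have ha2 : ContDiffOn ℝ 2 (uncurry V) (Ioo α β ×ˢ (univ : Set (EuclideanSpace ℝ (Fin 3)))) :=
    hcl.smooth_velocity.of_le (by norm_cast)
  have hπ1 : ContDiffOn ℝ 1 (uncurry q) (Ioo α β ×ˢ (univ : Set (EuclideanSpace ℝ (Fin 3)))) :=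
    hcl.smooth_pressure.of_le (by norm_cast)
  have hmom : ∀ t ∈ Ioo α β, ∀ x, timeDeriv V t x + convect (V t) (V t) x =
      (1 : ℝ) • (Δ (V t)) x - gradient (q t) x + (0 : ℝ → EuclideanSpace ℝ (Fin 3) → EuclideanSpace ℝ (Fin 3)) t x := by
    intro t ht x
    have h := hcl.momentum t ht x
    rwa [timeDerivWithin_of_mem_interior (by rwa [interior_Ioo]) x] at h
  have hD₂ : IsDistributionalNSSolutionOn Q 1 0 V q :=
    isDistributionalNSSolutionOn_of_contDiffOn isOpen_Ioo hQI ha2 hπ1 (continuous_const.continuousOn) hmom hcl.divFree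
  -- local integrability of `F = P - q` on the slab
  have hπc : ContinuousOn (uncurry q) (Q : Set (ℝ × EuclideanSpace ℝ (Fin 3))) := hπ1.continuousOn.mono hQI
  have hF : LocallyIntegrableOn (uncurry fun t x => P t x - q t x)
      (Ioo α β ×ˢ (univ : Set (EuclideanSpace ℝ (Fin 3)))) volume := by
    rw [← hQset]
    exact hD₁.2.2.1.sub (hπc.locallyIntegrableOn Q.isOpen.measurableSet)
  refine ae_exists_const_of_forall_integral_mul_divergence_eq_zero hF fun ψ hψ => ?_
  -- ### subtract the two momentum identities
  have h₁ := hD₁.2.2.2.2 ψ hψ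
  have h₂ := hD₂.2.2.2.2 ψ hψ
  set K : Set (ℝ × EuclideanSpace ℝ (Fin 3)) := tsupport (uncurry ψ) with hK
  have hKc : IsCompact K := hψ.hasCompactSupport
  have hKQ : K ⊆ (Q : Set (ℝ × EuclideanSpace ℝ (Fin 3))) := hψ.tsupport_subset
  have hψ' : IsSpaceTimeTestOn (⊤ : Opens (ℝ × EuclideanSpace ℝ (Fin 3))) ψ := hψ.mono le_top
  have hdivc : Continuous fun z : ℝ × EuclideanSpace ℝ (Fin 3) => VectorCalculus.divergence (ψ z.1) z.2 :=
    hψ'.continuous_divergence_slice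
  have hdiv0 : ∀ z ∉ K, VectorCalculus.divergence (ψ z.1) z.2 = 0 := fun z hz => by
    have h0 : fderiv ℝ (ψ z.1) z.2 = 0 := IsSpaceTimeTestOn.fderiv_slice_eq_zero_of_notMem (ψ := ψ) hz
    simp [VectorCalculus.divergence, h0]
  have iP₁ : Integrable (fun z : ℝ × EuclideanSpace ℝ (Fin 3) =>
      P z.1 z.2 * VectorCalculus.divergence (ψ z.1) z.2) volume :=
    integrable_mul_of_locallyIntegrableOn hD₁.2.2.1 hdivc hKc hKQ hdiv0
  have iP₂ : Integrable (fun z : ℝ × EuclideanSpace ℝ (Fin 3) =>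
      q z.1 z.2 * VectorCalculus.divergence (ψ z.1) z.2) volume :=
    integrable_mul_of_locallyIntegrableOn hD₂.2.2.1 hdivc hKc hKQ hdiv0
  set W : ℝ × EuclideanSpace ℝ (Fin 3) → ℝ := fun z => ⟪V z.1 z.2, timeDeriv ψ z.1 z.2⟫ +
    ⟪V z.1 z.2, convect (V z.1) (ψ z.1) z.2⟫ + 1 * ⟪V z.1 z.2, Δ (ψ z.1) z.2⟫ with hW
  have hW0 : ∀ z ∉ K, W z = 0 := fun z hz => by
    simp only [hW, IsSpaceTimeTestOn.timeDeriv_eq_zero_of_notMem hz,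
      laplacian_eq_zero_of_notMem_tsupport (notMem_tsupport_slice hz), inner_zero_right, mul_zero, add_zero,
      convect, IsSpaceTimeTestOn.fderiv_slice_eq_zero_of_notMem (ψ := ψ) hz, zero_apply]
  have hWc : ContinuousOn W (Q : Set (ℝ × EuclideanSpace ℝ (Fin 3))) := by
    have hac : ContinuousOn (fun z : ℝ × EuclideanSpace ℝ (Fin 3) => V z.1 z.2)
        (Q : Set (ℝ × EuclideanSpace ℝ (Fin 3))) := ha2.continuousOn.mono hQI
    have hDψ : Continuous fun z : ℝ × EuclideanSpace ℝ (Fin 3) => fderiv ℝ (ψ z.1) z.2 :=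
      hψ'.continuous_fderiv_slice
    refine ((hac.inner hψ'.continuous_timeDeriv.continuousOn).add (hac.inner ?_)).add
      (continuousOn_const.mul (hac.inner hψ'.continuous_laplacian_slice.continuousOn))
    exact ((hDψ.continuousOn).clm_apply hac)
  have iW : Integrable W volume := by
    have hWK : IntegrableOn W K volume := (hWc.mono hKQ).integrableOn_compact hKc
    exact hWK.integrable_of_forall_notMem_eq_zero hW0
  have e₁ : ∫ (z : ℝ × EuclideanSpace ℝ (Fin 3)) in (Q : Set (ℝ × EuclideanSpace ℝ (Fin 3))),
      (⟪V z.1 z.2, timeDeriv ψ z.1 z.2⟫ + ⟪V z.1 z.2, convect (V z.1) (ψ z.1) z.2⟫ +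
        1 * ⟪V z.1 z.2, Δ (ψ z.1) z.2⟫ + P z.1 z.2 * VectorCalculus.divergence (ψ z.1) z.2 +
        ⟪(0 : ℝ → EuclideanSpace ℝ (Fin 3) → EuclideanSpace ℝ (Fin 3)) z.1 z.2, ψ z.1 z.2⟫) =
      (∫ z, W z) + ∫ z : ℝ × EuclideanSpace ℝ (Fin 3), P z.1 z.2 * VectorCalculus.divergence (ψ z.1) z.2 := by
    rw [setIntegral_eq_integral_of_forall_compl_eq_zero (fun z hz => by
      have hzK : z ∉ K := fun h => hz (hKQ h)
      simp only [hW] at hW0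
      rw [hW0 z hzK, hdiv0 z hzK]; simp), ← integral_add iW iP₁]
    refine integral_congr_ae (Eventually.of_forall fun z => ?_)
    simp only [hW, Pi.zero_apply, inner_zero_left, add_zero]
  have e₂ : ∫ (z : ℝ × EuclideanSpace ℝ (Fin 3)) in (Q : Set (ℝ × EuclideanSpace ℝ (Fin 3))),
      (⟪V z.1 z.2, timeDeriv ψ z.1 z.2⟫ + ⟪V z.1 z.2, convect (V z.1) (ψ z.1) z.2⟫ +
        1 * ⟪V z.1 z.2, Δ (ψ z.1) z.2⟫ + q z.1 z.2 * VectorCalculus.divergence (ψ z.1) z.2 +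
        ⟪(0 : ℝ → EuclideanSpace ℝ (Fin 3) → EuclideanSpace ℝ (Fin 3)) z.1 z.2, ψ z.1 z.2⟫) =
      (∫ z, W z) + ∫ z : ℝ × EuclideanSpace ℝ (Fin 3), q z.1 z.2 * VectorCalculus.divergence (ψ z.1) z.2 := by
    rw [setIntegral_eq_integral_of_forall_compl_eq_zero (fun z hz => by
      have hzK : z ∉ K := fun h => hz (hKQ h)
      simp only [hW] at hW0
      rw [hW0 z hzK, hdiv0 z hzK]; simp), ← integral_add iW iP₂]
    refine integral_congr_ae (Eventually.of_forall fun z => ?_)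
    simp only [hW, Pi.zero_apply, inner_zero_left, add_zero]
  rw [e₁] at h₁
  rw [e₂] at h₂
  rw [setIntegral_eq_integral_of_forall_compl_eq_zero (fun z hz => by
    have hzK : z ∉ K := fun h => hz (hKQ h)
    rw [show VectorCalculus.divergence (ψ z.1) z.2 = 0 from hdiv0 z hzK, mul_zero])]
  have e3 : ∫ z : ℝ × EuclideanSpace ℝ (Fin 3), (P z.1 z.2 - q z.1 z.2) * VectorCalculus.divergence (ψ z.1) z.2 =
      ∫ z : ℝ × EuclideanSpace ℝ (Fin 3), (P z.1 z.2 * VectorCalculus.divergence (ψ z.1) z.2 -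
        q z.1 z.2 * VectorCalculus.divergence (ψ z.1) z.2) := by
    refine integral_congr_ae (Eventually.of_forall fun z => ?_)
    ring
  show ∫ z : ℝ × EuclideanSpace ℝ (Fin 3), (P z.1 z.2 - q z.1 z.2) * VectorCalculus.divergence (ψ z.1) z.2 = 0
  rw [e3, integral_sub iP₁ iP₂]
  linarith


/-- **Transfer of the shell budget to every window pressure, at every late time** (module docstring).
[folklore] -/
theorem reprBudget_of_shellBudget
    {U V : ℝ → EuclideanSpace ℝ (Fin 3) → EuclideanSpace ℝ (Fin 3)}
    {P : ℝ → EuclideanSpace ℝ (Fin 3) → ℝ}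
    (hsw : ∀ a : ℝ, 0 < a →
      IsSuitableWeakSolutionInBall a (0 : ℝ × EuclideanSpace ℝ (Fin 3)) U P)
    (hUV : ∀ᵐ w ∂(volume.restrict (Iio (0 : ℝ) ×ˢ (univ : Set (EuclideanSpace ℝ (Fin 3))))),
      uncurry U w = uncurry V w)
    {S K : Set (EuclideanSpace ℝ (Fin 3))} (hKc : IsCompact K) (hKS : K ⊆ S)
    {δ' mP : ℝ} (hmP : 0 ≤ mP) {c : ℝ → ℝ}
    (hP : ∀ᵐ s ∂(volume.restrict (Ioo (-δ') 0)),
      ∫⁻ y in S, ‖P s y - c s‖ₑ ≤ ENNReal.ofReal mP) :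
    ∀ t ∈ Ioo (-δ') 0, ∀ (α β : ℝ) (q : ℝ → EuclideanSpace ℝ (Fin 3) → ℝ), t ∈ Ioo α β →
      IsClassicalNSSolutionOn (Ioo α β) 1 0 V q →
      ∃ cst : ℝ, ∫ y in K, |q t y - cst| ≤ mP + 1 := by
  intro t ht α β q htαβ hcl
  -- ### the window `W = ]α', β'[ ⊆ ]α, β[ ∩ ]−δ', 0[` about `t`
  obtain ⟨α', hα'⟩ : ∃ α' : ℝ, α' = max α (-δ') := ⟨_, rfl⟩
  obtain ⟨β', hβ'⟩ : ∃ β' : ℝ, β' = min β 0 := ⟨_, rfl⟩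
  have htW : t ∈ Ioo α' β' := by
    rw [hα', hβ']; exact ⟨max_lt htαβ.1 ht.1, lt_min htαβ.2 ht.2⟩
  have hWsub : Ioo α' β' ⊆ Ioo α β := by
    rw [hα', hβ']; exact Ioo_subset_Ioo (le_max_left _ _) (min_le_left _ _)
  have hWδ : Ioo α' β' ⊆ Ioo (-δ') 0 := by
    rw [hα', hβ']; exact Ioo_subset_Ioo (le_max_right _ _) (min_le_right _ _)
  have hβ'0 : β' ≤ 0 := by rw [hβ']; exact min_le_right _ _
  have hclW : IsClassicalNSSolutionOn (Ioo α' β') 1 0 V q := hcl.mono hWsub (uniqueDiffOn_Ioo α' β')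
  -- ### a.e. late time of the window: the budget for `q`
  have hg := ae_exists_gauge_window_pressure hsw hUV hβ'0 hclW
  have hPW : ∀ᵐ t' ∂(volume.restrict (Ioo α' β')), ∫⁻ y in S, ‖P t' y - c t'‖ₑ ≤ ENNReal.ofReal mP :=
    ae_restrict_of_ae_restrict_of_subset hWδ hP
  have hae : ∀ᵐ t' ∂(volume.restrict (Ioo α' β')), t' ∈ Ioo α' β' →
      ∃ cst : ℝ, ∫ y in K, |q t' y - cst| ≤ mP := by
    filter_upwards [hg, hPW] with t' hκ hPt' ht'W
    obtain ⟨κ, hκ⟩ := hκ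
    refine ⟨c t' - κ, ?_⟩
    have hcont : Continuous (q t') := (hclW.contDiff_pressure ht'W).continuous
    have hint : IntegrableOn (fun y => |q t' y - (c t' - κ)|) K volume :=
      (hcont.sub continuous_const).abs.continuousOn.integrableOn_compact hKc
    rw [integral_eq_lintegral_of_nonneg_ae (ae_of_all _ fun y => abs_nonneg _) hint.aestronglyMeasurable]
    have hle : ∫⁻ y in K, ENNReal.ofReal |q t' y - (c t' - κ)| ≤ ENNReal.ofReal mP := by
      calc ∫⁻ y in K, ENNReal.ofReal |q t' y - (c t' - κ)| = ∫⁻ y in K, ‖P t' y - c t'‖ₑ := by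
            refine lintegral_congr_ae ?_
            filter_upwards [ae_restrict_of_ae (s := K) hκ] with y hy
            rw [← Real.enorm_eq_ofReal_abs, show q t' y - (c t' - κ) = P t' y - c t' by linarith]
        _ ≤ ∫⁻ y in S, ‖P t' y - c t'‖ₑ := lintegral_mono_set hKS
        _ ≤ ENNReal.ofReal mP := hPt'
    exact ENNReal.toReal_le_of_le_ofReal hmP hle
  -- ### upgrade to `t` itself by uniform continuity of `q` near `{t} × K`
  have htW1 : α' < t := htW.1
  have htW2 : t < β' := htW.2
  obtain ⟨η₀, hη₀, hη₀W⟩ : ∃ η₀ : ℝ, 0 < η₀ ∧ Icc (t - η₀) (t + η₀) ⊆ Ioo α' β' := by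
    have hm : 0 < min (t - α') (β' - t) := lt_min (by linarith) (by linarith)
    refine ⟨min (t - α') (β' - t) / 2, by positivity, fun s hs => ⟨?_, ?_⟩⟩
    · have h1 : min (t - α') (β' - t) ≤ t - α' := min_le_left _ _
      linarith [hs.1]
    · have h1 : min (t - α') (β' - t) ≤ β' - t := min_le_right _ _
      linarith [hs.2]
  have hqc : ContinuousOn (uncurry q) (Icc (t - η₀) (t + η₀) ×ˢ K) :=
    hclW.smooth_pressure.continuousOn.mono (prod_mono hη₀W (subset_univ _))
  have hCc : IsCompact (Icc (t - η₀) (t + η₀) ×ˢ K) := isCompact_Icc.prod hKc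
  have huc := hCc.uniformContinuousOn_of_continuous hqc
  rw [Metric.uniformContinuousOn_iff] at huc
  have hvol : 0 ≤ (volume K).toReal := ENNReal.toReal_nonneg
  obtain ⟨θ, hθ, hθuc⟩ := huc (1 / ((volume K).toReal + 1)) (by positivity)
  -- a good time `t'` within `min η₀ (θ/2)` of `t`
  obtain ⟨η, hηdef⟩ : ∃ η : ℝ, η = min η₀ (θ / 2) := ⟨_, rfl⟩
  have hη : 0 < η := by rw [hηdef]; exact lt_min hη₀ (half_pos hθ)
  have hηη₀ : η ≤ η₀ := by rw [hηdef]; exact min_le_left _ _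
  have hηθ : η < θ := by rw [hηdef]; linarith [min_le_right η₀ (θ / 2)]
  have hJW : Ioo (t - η) (t + η) ⊆ Ioo α' β' := fun s hs =>
    hη₀W ⟨by linarith [hs.1], by linarith [hs.2]⟩
  have hJ : volume.restrict (Ioo (t - η) (t + η)) ≠ 0 := by
    rw [Ne, Measure.restrict_eq_zero, Real.volume_Ioo]
    exact (ENNReal.ofReal_pos.2 (by linarith)).ne'
  haveI := ae_neBot.2 hJ
  have hgood : ∀ᵐ t' ∂(volume.restrict (Ioo (t - η) (t + η))),
      t' ∈ Ioo (t - η) (t + η) ∧ ∃ cst : ℝ, ∫ y in K, |q t' y - cst| ≤ mP := by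
    filter_upwards [ae_restrict_mem measurableSet_Ioo,
      ae_restrict_of_ae_restrict_of_subset hJW hae] with t' ht' h
    exact ⟨ht', h (hJW ht')⟩
  obtain ⟨t', ht'J, cst, hcst⟩ := hgood.exists
  refine ⟨cst, ?_⟩
  -- `|q(t) − cst| ≤ |q(t') − cst| + |q(t) − q(t')|` on `K`, and the last term is `< 1/(|K|+1)`
  have htC : ∀ y ∈ K, (t, y) ∈ Icc (t - η₀) (t + η₀) ×ˢ K := fun y hy =>
    ⟨⟨by linarith, by linarith⟩, hy⟩
  have ht'C : ∀ y ∈ K, (t', y) ∈ Icc (t - η₀) (t + η₀) ×ˢ K := fun y hy =>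
    ⟨⟨by linarith [ht'J.1], by linarith [ht'J.2]⟩, hy⟩
  have hclose : ∀ y ∈ K, |q t y - q t' y| ≤ 1 / ((volume K).toReal + 1) := by
    intro y hy
    have hd : dist ((t, y) : ℝ × EuclideanSpace ℝ (Fin 3)) (t', y) < θ := by
      rw [Prod.dist_eq, dist_self, max_eq_left dist_nonneg, Real.dist_eq]
      rw [abs_sub_lt_iff]; constructor <;> linarith [ht'J.1, ht'J.2]
    have h := hθuc (t, y) (htC y hy) (t', y) (ht'C y hy) hd
    rw [Real.dist_eq] at h
    exact h.le
  have hct : Continuous (q t) := (hclW.contDiff_pressure htW).continuous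
  have hct' : Continuous (q t') := (hclW.contDiff_pressure (hJW ht'J)).continuous
  have i1 : IntegrableOn (fun y => |q t' y - cst|) K volume :=
    (hct'.sub continuous_const).abs.continuousOn.integrableOn_compact hKc
  have i2 : IntegrableOn (fun y => |q t y - q t' y|) K volume :=
    (hct.sub hct').abs.continuousOn.integrableOn_compact hKc
  have i3 : IntegrableOn (fun _ => 1 / ((volume K).toReal + 1)) K volume :=
    continuous_const.continuousOn.integrableOn_compact hKc
  calc ∫ y in K, |q t y - cst| ≤ ∫ y in K, (|q t' y - cst| + |q t y - q t' y|) := by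
        refine setIntegral_mono_on ((hct.sub continuous_const).abs.continuousOn.integrableOn_compact hKc)
          (i1.add i2) hKc.measurableSet fun y _ => ?_
        calc |q t y - cst| = |(q t' y - cst) + (q t y - q t' y)| := by ring_nf
          _ ≤ |q t' y - cst| + |q t y - q t' y| := abs_add_le _ _
    _ = (∫ y in K, |q t' y - cst|) + ∫ y in K, |q t y - q t' y| := integral_add i1 i2
    _ ≤ mP + ∫ y in K, (1 / ((volume K).toReal + 1)) :=
        add_le_add hcst (setIntegral_mono_on i2 i3 hKc.measurableSet hclose)
    _ = mP + volume.real K * (1 / ((volume K).toReal + 1)) := by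
        rw [setIntegral_const, smul_eq_mul]
    _ ≤ mP + 1 := by
        have h : volume.real K * (1 / ((volume K).toReal + 1)) ≤ 1 := by
          rw [measureReal_def, mul_one_div, div_le_one (by positivity)]; linarith
        linarith

end Summit.NavierStokesRegularity.NavierStokesRegularity.Theorems.TypeITraceScarL3

end
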